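import Summits.CriticalPhenomena.CardyFormulaZ2.Theses.CardyRotToConf
import Literature.Topology.PlaneTopology.Crosscut
import HarnessLib

/-!
# Branch components of a Jordan curve in a ball about a boundary point
# (stub `stub_branchComponents`, line `germ-label-transport`, crux `stmt-CriticalPhenomena-0698`)

Pure planar topology serving the fat-germ surgery of the line `germ-label-transport` against
`Summit.CriticalPhenomena.CardyFormulaZ2.Theses.CardyRotToConf.CardyRotToConfR2SymmetryUpgrade`
(lead skeleton `Cruxes/CardyRotToConfR2SymmetryUpgrade/GermLabelTransport`, item S7e).

Let `D` be a Jordan domain with boundary loop `γ = D.boundary` (continuous, `1`-periodic,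
injective on every period `[s, s + 1)`, `range γ = ∂D`), let `a = γ t₀`, and let `B = B(a, r)`
be a ball NOT containing the whole curve. Let `δ₁, δ₂ > 0` be the FIRST-EXIT parameters from `B`
of the forward branch `s ↦ γ (t₀ + s)` and of the backward branch `s ↦ γ (t₀ - s)`. With
`S = (∂D ∩ B) ∖ {a}` we prove (`stub_branchComponents`):
* `δ₁ + δ₂ ≤ 1`, `γ (t₀, t₀ + δ₁) ⊆ B`, `γ (t₀ - δ₂, t₀) ⊆ B`;
* `γ (t₀, t₀ + δ₁)` and `γ (t₀ - δ₂, t₀)` are connected components of `S`;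
* they are the only connected components of `S` accumulating at `a`.

Proof. First exits exist by `IsClosed.csInf_mem`: the exit set `[0, T] ∩ (γ (t₀ ± ·))⁻¹ Bᶜ` is
closed, nonempty (the hypothesis and periodicity give a forward witness `T ∈ [0, 1)` and the
backward witness `1 - T`) and misses `0`; minimality over both witnesses gives `δ₁ + δ₂ ≤ 1`.
We then work in the period window `(t₀, t₀ + 1)`, where the backward branch reads
`γ (t₀ + 1 - δ₂, t₀ + 1)` (periodicity) and every point of `S` is `γ u` for a unique
`u ∈ (t₀, t₀ + 1)`. KEY SEPARATION LEMMA (`subset_image_Icc`): for `t₀ ≤ p ≤ q ≤ t₀ + 1` with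
`γ p, γ q ∉ S`, the compact arcs `F = γ [p, q]` and `G = γ ([t₀, p] ∪ [q, t₀ + 1])` cover `S` and
meet only off `S` (injectivity on the period), so a preconnected subset of `S` meeting `F` lies in
`F` (`isPreconnected_closed_iff`). With `(p, q) = (t₀, t₀ + δ₁)` and `(t₀ + 1 - δ₂, t₀ + 1)`
this identifies the two branch components (`connectedComponentIn_eq_image_Ioo`); with
`(p, q) = (t₀ + δ₁, t₀ + 1 - δ₂)` it confines every other component of `S` to the compact arc
`γ [t₀ + δ₁, t₀ + 1 - δ₂]`, which does not contain `a`.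

References: M. H. A. Newman, *Elements of the topology of plane sets of points* (1939), Ch. V
(arcs of a Jordan curve); the statement is folklore. Mathlib anchors: `connectedComponentIn`,
`isPreconnected_closed_iff`, `IsClosed.csInf_mem`, `Function.Periodic`, `Set.InjOn`.
-/

noncomputable section

open Set Metric Topology

namespace Summit.CriticalPhenomena.CardyFormulaZ2.Theorems.CardyRotToConfR2SymmetryUpgrade

open Literature.Probability.RandomPlanarGeometry

namespace BranchComponents

/-! ### Two generic lemmas -/

/-- **First exit of a continuous path from an open set.** If `f : ℝ → X` is continuous, `U` is
open, `f 0 ∈ U` and `f T ∉ U` for some `T ≥ 0`, then there is a least exit parameter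
`δ ∈ (0, T]`: `f δ ∉ U` and `f s ∈ U` for `0 ≤ s < δ` (infimum of the closed exit set
`[0, T] ∩ f ⁻¹ Uᶜ`). [folklore] -/
theorem exists_first_exit {X : Type*} [TopologicalSpace X] {f : ℝ → X} (hf : Continuous f)
    {U : Set X} (hU : IsOpen U) (h0 : f 0 ∈ U) {T : ℝ} (hT : 0 ≤ T) (hfT : f T ∉ U) :
    ∃ δ : ℝ, 0 < δ ∧ δ ≤ T ∧ f δ ∉ U ∧ ∀ s, 0 ≤ s → s < δ → f s ∈ U := by
  set E : Set ℝ := Icc 0 T ∩ f ⁻¹' Uᶜ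
  have hEc : IsClosed E := isClosed_Icc.inter (hU.isClosed_compl.preimage hf)
  have hTE : T ∈ E := ⟨⟨hT, le_rfl⟩, hfT⟩
  have hEb : BddBelow E := ⟨0, fun x hx => hx.1.1⟩
  have hmem : sInf E ∈ E := hEc.csInf_mem ⟨T, hTE⟩ hEb
  refine ⟨sInf E, lt_of_le_of_ne hmem.1.1 fun h => hmem.2 ?_, csInf_le hEb hTE, hmem.2,
    fun s hs0 hs => ?_⟩
  · rw [← h]
    exact h0
  · by_contra hsU
    exact not_lt.2 (csInf_le hEb ⟨⟨hs0, hs.le.trans (csInf_le hEb hTE)⟩, hsU⟩) hs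

/-- **Two closed pieces.** If `S ⊆ F ∪ G` with `F`, `G` closed and `F ∩ G` disjoint from `S`,
then a preconnected `C ⊆ S` meeting `F` is contained in `F` (`isPreconnected_closed_iff`).
[folklore] -/
theorem isPreconnected_subset_of_closed_cover {X : Type*} [TopologicalSpace X]
    {C S F G : Set X} (hC : IsPreconnected C) (hCS : C ⊆ S) (hF : IsClosed F) (hG : IsClosed G)
    (hSFG : S ⊆ F ∪ G) (hdisj : ∀ z ∈ S, z ∈ F → z ∈ G → False) (hCF : (C ∩ F).Nonempty) :
    C ⊆ F := by
  have hcov : C ⊆ F ∪ G := hCS.trans hSFG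
  have hCG : ¬ (C ∩ G).Nonempty := by
    intro hCG
    obtain ⟨z, hzC, hzF, hzG⟩ := isPreconnected_closed_iff.1 hC F G hF hG hcov hCF hCG
    exact hdisj z (hCS hzC) hzF hzG
  exact fun z hzC => (hcov hzC).resolve_right fun hzG => hCG ⟨z, hzC, hzG⟩

/-! ### The boundary loop in the period window `(t₀, t₀ + 1)` -/

variable (D : JordanDomain)

/-- Periodicity in the form `γ (t₀ + fract y) = γ (t₀ + y)`. [folklore] -/
theorem boundary_add_fract (t₀ y : ℝ) :
    D.boundary (t₀ + Int.fract y) = D.boundary (t₀ + y) := by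
  rw [show t₀ + Int.fract y = t₀ + y - (⌊y⌋ : ℤ) * (1 : ℝ) by rw [Int.fract]; ring]
  exact D.periodic_boundary.sub_int_mul_eq ⌊y⌋

/-- Periodicity: the backward branch `γ (t₀ - δ, t₀)` is the arc `γ (t₀ + 1 - δ, t₀ + 1)` of
the period window. [folklore] -/
theorem image_Ioo_sub_eq (t₀ δ : ℝ) :
    D.boundary '' Ioo (t₀ - δ) t₀ = D.boundary '' Ioo (t₀ + 1 - δ) (t₀ + 1) := by
  have h : (fun x => D.boundary (x + 1)) = D.boundary := funext D.periodic_boundary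
  rw [show Ioo (t₀ + 1 - δ) (t₀ + 1) = (fun x => x + 1) '' Ioo (t₀ - δ) t₀ by
    rw [image_add_const_Ioo]; congr 1; ring, image_image, h]

/-- Injectivity on the period: `γ u ≠ γ t₀` for `u ∈ (t₀, t₀ + 1)`. [folklore] -/
theorem boundary_ne_of_mem_Ioo {t₀ u : ℝ} (hu : u ∈ Ioo t₀ (t₀ + 1)) :
    D.boundary u ≠ D.boundary t₀ := fun h =>
  hu.1.ne' (D.injOn_boundary_Ico t₀ ⟨hu.1.le, hu.2⟩ ⟨le_rfl, lt_add_one t₀⟩ h)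

/-- Every point of `S = (∂D ∩ B(γ t₀, r)) ∖ {γ t₀}` is `γ u` for some `u` in the open period
window `(t₀, t₀ + 1)`. [folklore] -/
theorem exists_mem_Ioo_of_mem {t₀ r : ℝ} {z : ℂ}
    (hz : z ∈ (frontier D.carrier ∩ ball (D.boundary t₀) r) \ {D.boundary t₀}) :
    ∃ u ∈ Ioo t₀ (t₀ + 1), D.boundary u = z := by
  obtain ⟨⟨hzf, -⟩, hza⟩ := hz
  rw [← D.range_boundary] at hzf
  obtain ⟨t, rfl⟩ := hzf
  have h : D.boundary (t₀ + Int.fract (t - t₀)) = D.boundary t := by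
    rw [boundary_add_fract D]; congr 1; ring
  refine ⟨t₀ + Int.fract (t - t₀), ⟨?_, by linarith [Int.fract_lt_one (t - t₀)]⟩, h⟩
  have hne : Int.fract (t - t₀) ≠ 0 := by
    intro h0
    rw [h0, add_zero] at h
    exact hza (mem_singleton_iff.2 h.symm)
  have := lt_of_le_of_ne (Int.fract_nonneg (t - t₀)) hne.symm
  linarith

/-- A parameter of the closed period `[t₀, t₀ + 1]` whose image lies in `S` is in the open
period `(t₀, t₀ + 1)` (both end points are mapped to `γ t₀ ∉ S`). [folklore] -/
theorem mem_Ioo_of_mem_Icc {t₀ r u : ℝ} (hu : u ∈ Icc t₀ (t₀ + 1))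
    (huS : D.boundary u ∈ (frontier D.carrier ∩ ball (D.boundary t₀) r) \ {D.boundary t₀}) :
    u ∈ Ioo t₀ (t₀ + 1) := by
  refine ⟨hu.1.lt_of_ne ?_, hu.2.lt_of_ne ?_⟩
  · rintro rfl
    exact huS.2 (mem_singleton _)
  · intro h
    apply huS.2
    rw [mem_singleton_iff, h]
    exact D.periodic_boundary t₀

/-- **Key separation lemma.** For `t₀ ≤ p ≤ q ≤ t₀ + 1` with `γ p, γ q ∉ S`, a preconnected
subset of `S = (∂D ∩ B(γ t₀, r)) ∖ {γ t₀}` meeting the compact arc `γ [p, q]` is contained in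
it: `S` is covered by the closed sets `γ [p, q]` and `γ ([t₀, p] ∪ [q, t₀ + 1])`, which by
injectivity on the period meet only in `γ p`, `γ q`, `γ t₀`, all off `S`. [folklore] -/
theorem subset_image_Icc {t₀ r p q : ℝ} (hp : t₀ ≤ p) (hpq : p ≤ q) (hq : q ≤ t₀ + 1)
    (hpS : D.boundary p ∉ (frontier D.carrier ∩ ball (D.boundary t₀) r) \ {D.boundary t₀})
    (hqS : D.boundary q ∉ (frontier D.carrier ∩ ball (D.boundary t₀) r) \ {D.boundary t₀})
    {C : Set ℂ} (hC : IsPreconnected C)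
    (hCS : C ⊆ (frontier D.carrier ∩ ball (D.boundary t₀) r) \ {D.boundary t₀})
    (hCF : (C ∩ D.boundary '' Icc p q).Nonempty) :
    C ⊆ D.boundary '' Icc p q := by
  have hγ := D.continuous_boundary
  refine isPreconnected_subset_of_closed_cover (G := D.boundary '' (Icc t₀ p ∪ Icc q (t₀ + 1)))
    hC hCS (isCompact_Icc.image hγ).isClosed ((isCompact_Icc.union isCompact_Icc).image hγ).isClosed
    (fun z hz => ?_) ?_ hCF
  · obtain ⟨u, hu, rfl⟩ := exists_mem_Ioo_of_mem D hz
    rcases lt_or_ge u p with hup | hup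
    · exact Or.inr ⟨u, Or.inl ⟨hu.1.le, hup.le⟩, rfl⟩
    rcases le_or_gt u q with huq | huq
    · exact Or.inl ⟨u, ⟨hup, huq⟩, rfl⟩
    · exact Or.inr ⟨u, Or.inr ⟨huq.le, hu.2.le⟩, rfl⟩
  · rintro z hzS ⟨u, hu, rfl⟩ ⟨v, hv, huv⟩
    have hu' : u ∈ Ioo t₀ (t₀ + 1) := mem_Ioo_of_mem_Icc D ⟨hp.trans hu.1, hu.2.trans hq⟩ hzS
    have hvI : v ∈ Icc t₀ (t₀ + 1) := hv.elim (fun h => ⟨h.1, h.2.trans (hpq.trans hq)⟩)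
      fun h => ⟨hp.trans (hpq.trans h.1), h.2⟩
    have hv' : v ∈ Ioo t₀ (t₀ + 1) := mem_Ioo_of_mem_Icc D hvI (by rw [huv]; exact hzS)
    have hvu : v = u := D.injOn_boundary_Ico t₀ ⟨hv'.1.le, hv'.2⟩ ⟨hu'.1.le, hu'.2⟩ huv
    rw [hvu] at hv
    rcases hv with hv | hv
    · exact hpS (by rwa [le_antisymm hu.1 hv.2])
    · exact hqS (by rwa [le_antisymm hv.1 hu.2])

/-- **Branch components.** For `t₀ ≤ p < q ≤ t₀ + 1` with `γ p, γ q ∉ S` and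
`γ (p, q) ⊆ B(γ t₀, r)`, the open arc `γ (p, q)` is the connected component in
`S = (∂D ∩ B(γ t₀, r)) ∖ {γ t₀}` of each of its points. [folklore] -/
theorem connectedComponentIn_eq_image_Ioo {t₀ r p q : ℝ} (hp : t₀ ≤ p) (hq : q ≤ t₀ + 1)
    (hpS : D.boundary p ∉ (frontier D.carrier ∩ ball (D.boundary t₀) r) \ {D.boundary t₀})
    (hqS : D.boundary q ∉ (frontier D.carrier ∩ ball (D.boundary t₀) r) \ {D.boundary t₀})
    (hin : D.boundary '' Ioo p q ⊆ ball (D.boundary t₀) r)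
    {x : ℂ} (hx : x ∈ D.boundary '' Ioo p q) :
    connectedComponentIn ((frontier D.carrier ∩ ball (D.boundary t₀) r) \ {D.boundary t₀}) x =
      D.boundary '' Ioo p q := by
  have hAS : D.boundary '' Ioo p q ⊆
      (frontier D.carrier ∩ ball (D.boundary t₀) r) \ {D.boundary t₀} := by
    rintro _ ⟨u, hu, rfl⟩
    exact ⟨⟨D.boundary_mem_frontier u, hin (mem_image_of_mem _ hu)⟩, fun h =>
      boundary_ne_of_mem_Ioo D ⟨hp.trans_lt hu.1, hu.2.trans_le hq⟩ (mem_singleton_iff.1 h)⟩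
  obtain ⟨u₀, hu₀, rfl⟩ := hx
  have hpq : p < q := hu₀.1.trans hu₀.2
  have hx : D.boundary u₀ ∈ D.boundary '' Ioo p q := mem_image_of_mem _ hu₀
  refine Subset.antisymm (fun z hz => ?_)
    ((isPreconnected_Ioo.image _ D.continuous_boundary.continuousOn).subset_connectedComponentIn
      hx hAS)
  have hzS := connectedComponentIn_subset _ _ hz
  have hzF : z ∈ D.boundary '' Icc p q :=
    subset_image_Icc D hp hpq.le hq hpS hqS isPreconnected_connectedComponentIn
      (connectedComponentIn_subset _ _)
      ⟨_, mem_connectedComponentIn (hAS hx), image_mono Ioo_subset_Icc_self hx⟩ hz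
  obtain ⟨u, hu, rfl⟩ := hzF
  refine ⟨u, ⟨hu.1.lt_of_ne ?_, hu.2.lt_of_ne ?_⟩, rfl⟩
  · rintro rfl
    exact hpS hzS
  · rintro rfl
    exact hqS hzS

end BranchComponents

open BranchComponents in
/-- **S7e. Branch components** (pure planar topology). For a Jordan domain `D`, a boundary point
`a = ∂D(t₀) = D.boundary t₀` and a ball `B(a, r)` not containing the whole boundary curve, let
`δ₁, δ₂ > 0` be the first-exit parameters of the two boundary branches at `a` from the ball. Then
`δ₁ + δ₂ ≤ 1`, the open branches `D.boundary '' (t₀, t₀ + δ₁)` and `D.boundary '' (t₀ - δ₂, t₀)`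
lie in the ball, each is a connected component of `(∂D ∩ B(a, r)) ∖ {a}`, and they are the only
connected components of `(∂D ∩ B(a, r)) ∖ {a}` whose closure contains `a`. [folklore] -/
theorem stub_branchComponents :
    ∀ (D : JordanDomain) (t₀ r : ℝ), 0 < r →
      (∃ t : ℝ, D.boundary t ∉ Metric.ball (D.boundary t₀) r) →
      ∃ δ₁ δ₂ : ℝ, 0 < δ₁ ∧ 0 < δ₂ ∧ δ₁ + δ₂ ≤ 1 ∧
        D.boundary '' Set.Ioo t₀ (t₀ + δ₁) ⊆ Metric.ball (D.boundary t₀) r ∧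
        D.boundary '' Set.Ioo (t₀ - δ₂) t₀ ⊆ Metric.ball (D.boundary t₀) r ∧
        (∀ x ∈ D.boundary '' Set.Ioo t₀ (t₀ + δ₁),
          connectedComponentIn
              ((frontier D.carrier ∩ Metric.ball (D.boundary t₀) r) \ {D.boundary t₀}) x =
            D.boundary '' Set.Ioo t₀ (t₀ + δ₁)) ∧
        (∀ x ∈ D.boundary '' Set.Ioo (t₀ - δ₂) t₀,
          connectedComponentIn
              ((frontier D.carrier ∩ Metric.ball (D.boundary t₀) r) \ {D.boundary t₀}) x =
            D.boundary '' Set.Ioo (t₀ - δ₂) t₀) ∧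
        (∀ x ∈ (frontier D.carrier ∩ Metric.ball (D.boundary t₀) r) \ {D.boundary t₀},
          D.boundary t₀ ∈ closure (connectedComponentIn
              ((frontier D.carrier ∩ Metric.ball (D.boundary t₀) r) \ {D.boundary t₀}) x) →
          connectedComponentIn
                ((frontier D.carrier ∩ Metric.ball (D.boundary t₀) r) \ {D.boundary t₀}) x =
              D.boundary '' Set.Ioo t₀ (t₀ + δ₁) ∨
            connectedComponentIn
                ((frontier D.carrier ∩ Metric.ball (D.boundary t₀) r) \ {D.boundary t₀}) x =
              D.boundary '' Set.Ioo (t₀ - δ₂) t₀) := by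
  intro D t₀ r hr ht
  obtain ⟨t, ht⟩ := ht
  have hγ := D.continuous_boundary
  -- the forward witness parameter `T ∈ [0, 1)` with `γ (t₀ + T) = γ t ∉ B`
  set T : ℝ := Int.fract (t - t₀) with hT
  have hT0 : 0 ≤ T := Int.fract_nonneg _
  have hT1 : T < 1 := Int.fract_lt_one _
  have hγT : D.boundary (t₀ + T) = D.boundary t := by
    rw [hT, boundary_add_fract D]; congr 1; ring
  have ha : D.boundary t₀ ∈ ball (D.boundary t₀) r := mem_ball_self hr
  -- first exits of the forward branch `γ (t₀ + s)` and of the backward branch `γ (t₀ + 1 - s)`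
  obtain ⟨δ₁, hδ₁, hδ₁T, hout₁, hin₁⟩ := exists_first_exit (f := fun s => D.boundary (t₀ + s))
    (U := ball (D.boundary t₀) r) (hγ.comp' (by fun_prop)) isOpen_ball (by simpa using ha) hT0
    (show D.boundary (t₀ + T) ∉ ball (D.boundary t₀) r by rwa [hγT])
  obtain ⟨δ₂, hδ₂, hδ₂T, hout₂, hin₂⟩ := exists_first_exit (f := fun s => D.boundary (t₀ + 1 - s))
    (U := ball (D.boundary t₀) r) (hγ.comp' (by fun_prop)) isOpen_ball
    (by simpa [D.periodic_boundary t₀] using ha) (sub_nonneg.2 hT1.le)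
    (show D.boundary (t₀ + 1 - (1 - T)) ∉ ball (D.boundary t₀) r by
      rwa [show t₀ + 1 - (1 - T) = t₀ + T by ring, hγT])
  have h12 : δ₁ + δ₂ ≤ 1 := by linarith
  -- the two open branches lie in the ball
  have hin₁' : D.boundary '' Ioo t₀ (t₀ + δ₁) ⊆ ball (D.boundary t₀) r := by
    rintro _ ⟨u, hu, rfl⟩
    have := hin₁ (u - t₀) (by linarith [hu.1]) (by linarith [hu.2])
    simpa using this
  have hin₂' : D.boundary '' Ioo (t₀ + 1 - δ₂) (t₀ + 1) ⊆ ball (D.boundary t₀) r := by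
    rintro _ ⟨u, hu, rfl⟩
    have := hin₂ (t₀ + 1 - u) (by linarith [hu.2]) (by linarith [hu.1])
    simpa using this
  have hL : D.boundary '' Ioo (t₀ - δ₂) t₀ = D.boundary '' Ioo (t₀ + 1 - δ₂) (t₀ + 1) :=
    image_Ioo_sub_eq D t₀ δ₂
  -- the end points `γ t₀ = γ (t₀ + 1)`, `γ (t₀ + δ₁)`, `γ (t₀ + 1 - δ₂)` are off `S`
  set S : Set ℂ := (frontier D.carrier ∩ ball (D.boundary t₀) r) \ {D.boundary t₀} with hS
  have h0S : D.boundary t₀ ∉ S := fun h => h.2 (mem_singleton _)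
  have h1S : D.boundary (t₀ + 1) ∉ S := fun h =>
    h.2 (mem_singleton_iff.2 (D.periodic_boundary t₀))
  have hδ₁S : D.boundary (t₀ + δ₁) ∉ S := fun h => hout₁ h.1.2
  have hδ₂S : D.boundary (t₀ + 1 - δ₂) ∉ S := fun h => hout₂ h.1.2
  -- the two branch components
  have hR : ∀ x ∈ D.boundary '' Ioo t₀ (t₀ + δ₁),
      connectedComponentIn S x = D.boundary '' Ioo t₀ (t₀ + δ₁) := fun x hx =>
    connectedComponentIn_eq_image_Ioo D le_rfl (by linarith) h0S hδ₁S hin₁' hx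
  have hL' : ∀ x ∈ D.boundary '' Ioo (t₀ + 1 - δ₂) (t₀ + 1),
      connectedComponentIn S x = D.boundary '' Ioo (t₀ + 1 - δ₂) (t₀ + 1) := fun x hx =>
    connectedComponentIn_eq_image_Ioo D (by linarith) le_rfl hδ₂S h1S hin₂' hx
  refine ⟨δ₁, δ₂, hδ₁, hδ₂, h12, hin₁', by rw [hL]; exact hin₂', hR, by rw [hL]; exact hL', ?_⟩
  -- a component accumulating at `a` is one of the two branches
  intro x hxS hxa
  rw [hL]
  obtain ⟨u, hu, rfl⟩ := exists_mem_Ioo_of_mem D hxS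
  rcases lt_or_ge u (t₀ + δ₁) with hu₁ | hu₁
  · exact Or.inl (hR _ ⟨u, ⟨hu.1, hu₁⟩, rfl⟩)
  rcases lt_or_ge (t₀ + 1 - δ₂) u with hu₂ | hu₂
  · exact Or.inr (hL' _ ⟨u, ⟨hu₂, hu.2⟩, rfl⟩)
  exfalso
  -- otherwise the component lies in the compact middle arc `γ [t₀ + δ₁, t₀ + 1 - δ₂] ∌ a`
  have hCF : connectedComponentIn S (D.boundary u) ⊆
      D.boundary '' Icc (t₀ + δ₁) (t₀ + 1 - δ₂) :=
    subset_image_Icc D (by linarith) (by linarith) (by linarith) hδ₁S hδ₂S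
      isPreconnected_connectedComponentIn (connectedComponentIn_subset _ _)
      ⟨_, mem_connectedComponentIn hxS, u, ⟨hu₁, hu₂⟩, rfl⟩
  obtain ⟨v, hv, hva⟩ := closure_minimal hCF (isCompact_Icc.image hγ).isClosed hxa
  exact boundary_ne_of_mem_Ioo D ⟨by linarith [hv.1], by linarith [hv.2]⟩ hva

end Summit.CriticalPhenomena.CardyFormulaZ2.Theorems.CardyRotToConfR2SymmetryUpgrade
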